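import Literature.Barriers.SmoothPoincare4.ExoticOpenFourSpace
import Literature.Topology.FourManifolds.SmallExoticRFour
import HarnessLib

/-!
# Barrier (SmoothPoincare4) `OpenAnalogueBarrierFour`: reduction to the Casson–Freedman end data

Second proof file of `ExoticOpenFourSpace.lean` (barrier catalogue, D-0021) — the first,
`ExoticOpenFourSpaceProofs.lean`, belongs to the fact seat of `deMichelisFreedman1992_continuum`
(DeMichelis–Freedman's Cor. 4.1 in ZFC) and is untouched here. This one is the fact seat of
`Literature.Barriers.SmoothPoincare4.OpenAnalogueBarrierFour` (`¬ OpenSubsetUniquenessFour`: some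
open subset of `ℝ⁴` homeomorphic to `ℝ⁴` is not diffeomorphic to `ℝ⁴`). That file proves
`openAnalogueBarrierFour_iff_exoticR4 : OpenAnalogueBarrierFour ↔ spc4.S11`
(`Literature.Topology.FourManifolds.exists_opens_nonempty_homeomorph_isEmpty_diffeomorph_euclideanSpace_four`,
Mathlib's `proof_wanted exists_open_nonempty_homeomorph_isEmpty_diffeomorph_euclideanSpace_four`),
so an unconditional `OpenAnalogueBarrierFour_holds` is an unconditional Lean proof that a small
exotic `ℝ⁴` exists — the classical theorem "Casson + Freedman + Donaldson ⟹ exotic `ℝ⁴`" (Kirby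
1989, Ch. XIV, Thm. 3), whose inputs are two theories absent from Mathlib (provefact triage: XL).

## What is landed

The classical proof consists of two deep inputs and an elementary bridge between them, and the
bridge is PROVED (`Literature/Topology/FourManifolds/SmallExoticRFour.lean` with
`SphereBallTransfer.lean`, `PalaisComplementBallCollar.lean`, `PalaisComplementBallInversion.lean`):
`Literature.Topology.FourManifolds.PartialProductEnds.nonempty_diffeomorph` — two smooth
4-manifolds carrying the END DATA `Literature.Topology.FourManifolds.PartialProductEnds X₀ X₁` of
a partial smooth product structure (`HCobordismPartialProduct.lean`: open `ℝ⁴`-homeomorphs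
`Zᵢ ⊆ Xᵢ` smoothly embedded in `S⁴`, compact sets `Kᵢ ⊆ Zᵢ`, a diffeomorphism
`X₀ ∖ K₀ ≅ X₁ ∖ K₁` respecting the `Zᵢ`, and a compatible diffeomorphism `S⁴ ∖ j₀ K₀ ≅ S⁴ ∖ j₁ K₁`)
are diffeomorphic as soon as every open `ℝ⁴`-homeomorph in `ℝ⁴` is diffeomorphic to `ℝ⁴`
(Kirby's regluing argument, p. 101).

The two deep inputs enter the theorems of this file as HYPOTHESES — a pair of smooth
4-manifolds `X₀`, `X₁` carrying such end data (`P`) which are not diffeomorphic (`hE`):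

* (A) in the source the pair is Donaldson's, `X₀ = L(2,3)` (Dolgachev surface),
  `X₁ = CP² ♯ 9(−CP²)`, smoothly h-cobordant and "not diffeomorphic" (Kirby p. 98; the abstract
  form is the tree's fact spc4.S16,
  `Literature.Topology.FourManifolds.exists_isHCobordant_isEmpty_diffeomorph_four`, Donaldson 1987);
* (B) the end data is the Casson–Freedman analysis of the h-cobordism between them (Kirby
  pp. 99–101: a handlebody with 2- and 3-handles only, Casson handles in the middle level,
  `Z ≈ ℝ⁴ × I` by Freedman's Thm. 1.1, `Z ⊂ S⁴ × I` with the two smooth product structures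
  coinciding off the compact set `X`; for an arbitrary simply connected h-cobordism, without
  the `S⁴ × I` clause, De Michelis–Freedman 1992, Thm. 3.1).

Here: `openAnalogueBarrierFour_of_partialProductEnds`,
`exists_opens_sphere_homeomorph_not_diffeomorph_of_partialProductEnds`,
`not_forall_opens_sphere_diffeomorph_of_partialProductEnds` — **the barrier, and Kirby's
Thm. XIV.3 as printed ("an exotic `ℝ⁴_Θ` which imbeds smoothly in `S⁴`"), relative to the end
data of ONE non-diffeomorphic pair** (trust base: the hypotheses `P`, `hE`; no named fact).

## What is NOT landed, and why (A), (B) are hypotheses rather than named facts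

`OpenAnalogueBarrierFour_holds` (unconditional). It needs (A) (Donaldson's theorem: Yang–Mills
moduli spaces / the `Γ`-invariant — gauge theory) and (B) (Freedman's Thm. 1.1 "Casson handles
are TOP open 2-handles": decomposition space theory and Bing shrinking; Casson's imbedding
theorem; handle trading on the h-cobordism and the imbedding `Z ⊂ S⁴ × I`), cf. the triage in
`HCobordismFreedman.lean`; the objects of (B) (Casson handles) are not yet definable in the tree.

Earlier revisions of this seat vendored (B) as named facts of `HCobordismPartialProduct.lean`
minted for the purpose — the universal `cassonFreedman_partialProductEnds` (every pair of simply
connected closed smooth 4-manifolds that are smoothly h-cobordant carries the end data) and the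
existential `kirby1989_partialProductEnds` ((A) ∧ (B) for one pair) — and proved the barrier
relative to them. The D-0026 reviews of that decomposition (2026-08-15) merged both back into
this barrier's single proof obligation: the existential first (it was (A) ∧ (B) specialised),
then the universal, which this file therefore no longer uses (its consumers in
`SmallExoticRFour.lean` and the `def` itself go in the same review). Grounds for the latter:
it is not M-sized but a theory (Freedman's Thm. 1.1 and Casson's theorem, whose objects the
tree cannot yet define), so its prove seat could only block; and its `S⁴`-compatibility clause
is printed for ONE h-cobordism, inside Kirby's proof of Thm. XIV.3 (the parent statement here),
not as a theorem about all simply connected h-cobordisms — De Michelis–Freedman (p. 239) refer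
to "[14, p. 101]" for that argument instead of stating it. What the sources print is exactly the
hypothesis shape `P`, `hE` used below.

## References

[Kirby1989] Ch. XIV Thm. 3 (proof pp. 98–101) · [DeMichelisFreedman1992] Thm. 3.1 and p. 239 ·
[FreedmanJDG1982] Thm. 1.1 · [DonaldsonIrrationality1987] p. 142
-/

noncomputable section

open scoped Manifold ContDiff
open TopologicalSpace Set

namespace Literature.Barriers.SmoothPoincare4

/-! ### Relative to the end data of one non-diffeomorphic pair (Kirby's Theorem XIV.3 as data) -/

section OnePair

variable {X₀ X₁ : Type} [TopologicalSpace X₀] [T2Space X₀]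
  [ChartedSpace (EuclideanSpace ℝ (Fin 4)) X₀]
  [TopologicalSpace X₁] [T2Space X₁] [ChartedSpace (EuclideanSpace ℝ (Fin 4)) X₁]

/-- **`OpenAnalogueBarrierFour` from the end data of one non-diffeomorphic pair** (Kirby 1989,
Ch. XIV, proof of Thm. 3, pp. 98–101: for `X₀ = L(2,3)` and `X₁ = CP² ♯ 9(−CP²)`, "not
diffeomorphic" by Donaldson, the partial smooth product structure of the h-cobordism `Y` leaves
the end data `PartialProductEnds X₀ X₁`). If the technique's master statement
`OpenSubsetUniquenessFour` held, Kirby's regluing argument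
(`Literature.Topology.FourManifolds.PartialProductEnds.nonempty_diffeomorph`, p. 101) would make
`X₀` and `X₁` diffeomorphic. [cite: Kirby1989, Ch. XIV Thm. 3 (proof pp. 98-101)] -/
theorem openAnalogueBarrierFour_of_partialProductEnds
    (P : Literature.Topology.FourManifolds.PartialProductEnds X₀ X₁)
    (hE : IsEmpty (X₀ ≃ₘ⟮𝓡 4, 𝓡 4⟯ X₁)) : OpenAnalogueBarrierFour := by
  intro h
  obtain ⟨d⟩ := P.nonempty_diffeomorph h
  exact hE.false d

/-- **Kirby's Theorem XIV.3 as printed — "There exists an exotic `ℝ⁴_Θ` which imbeds smoothly in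
`S⁴`" — relative to the end data of one non-diffeomorphic pair**: the standard smooth `S⁴`
(Mathlib's `Metric.sphere 0 1 ⊂ ℝ⁵`) has an open subset homeomorphic but not diffeomorphic to
`ℝ⁴` (`exists_opens_sphere_homeomorph_not_diffeomorph` of `ExoticOpenFourSpace.lean` fed with
`openAnalogueBarrierFour_iff_exoticR4`). [cite: Kirby1989, Ch. XIV Thm. 3 (proof pp. 98-101)] -/
theorem exists_opens_sphere_homeomorph_not_diffeomorph_of_partialProductEnds
    (P : Literature.Topology.FourManifolds.PartialProductEnds X₀ X₁)
    (hE : IsEmpty (X₀ ≃ₘ⟮𝓡 4, 𝓡 4⟯ X₁)) :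
    ∃ U : Opens (Metric.sphere (0 : EuclideanSpace ℝ (Fin (4 + 1))) 1),
      Nonempty (U ≃ₜ EuclideanSpace ℝ (Fin 4)) ∧
        IsEmpty (U ≃ₘ⟮𝓡 4, 𝓡 4⟯ EuclideanSpace ℝ (Fin 4)) :=
  exists_opens_sphere_homeomorph_not_diffeomorph
    (openAnalogueBarrierFour_iff_exoticR4.mp (openAnalogueBarrierFour_of_partialProductEnds P hE))

/-- Hence, relative to the end data of one non-diffeomorphic pair, not every open subset of the
standard `S⁴` homeomorphic to `ℝ⁴` is diffeomorphic to `ℝ⁴` (the `S⁴`-form of the barrier).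
[cite: Kirby1989, Ch. XIV Thm. 3 (proof pp. 98-101)] -/
theorem not_forall_opens_sphere_diffeomorph_of_partialProductEnds
    (P : Literature.Topology.FourManifolds.PartialProductEnds X₀ X₁)
    (hE : IsEmpty (X₀ ≃ₘ⟮𝓡 4, 𝓡 4⟯ X₁)) :
    ¬ ∀ U : Opens (Metric.sphere (0 : EuclideanSpace ℝ (Fin (4 + 1))) 1),
      Nonempty (U ≃ₜ EuclideanSpace ℝ (Fin 4)) →
        Nonempty (U ≃ₘ⟮𝓡 4, 𝓡 4⟯ EuclideanSpace ℝ (Fin 4)) :=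
  not_forall_opens_sphere_diffeomorph
    (openAnalogueBarrierFour_iff_exoticR4.mp (openAnalogueBarrierFour_of_partialProductEnds P hE))

end OnePair

end Literature.Barriers.SmoothPoincare4

end
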